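import Mathlib
import Summits.MatrixMultiplication.MatrixMultiplication.Theses.FidelityWitnesses
import Literature.Computability.AlgebraicComplexity.AlderStrassen
import Literature.Computability.AlgebraicComplexity.MatMulRankLowerBoundsProofs

/-!
# `FidelityWitnesses.SixEighthsAtFive` (stmt-MatrixMultiplication-14040) — reduction to the one-slot Koszul cone

The item is `M(2,5) ≤ 6`: `‖Σ S·⟨2,2,2⟩‖² ≤ 6 · Σ‖S‖²` for every tensor `S` of rank `≤ 5` in the
`2 × 2` format.  This file lands the kernel-checked reduction

  `SixEighthsAtFive ⟸ (the same inequality for every S in the ONE-SLOT KOSZUL CONE V_A)`,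

where `V_A := {S | rank K_Φ(S) ≤ 10 for every Φ : ℂ^{2×2} →ₗ ℂ³}`, `K_Φ = koszulFlattening 1 Φ` the
`12 × 12` Landsberg–Ottaviani (`p = 1`) flattening on the OUTPUT slot — Ottaviani's form of
Strassen's commutator equations for `σ₅(ℂ⁴ ⊗ ℂ⁴ ⊗ ℂ⁴)`.  Rank `≤ 5` tensors lie in `V_A`
(`rank_koszulFlattening_sum_triad_le`: each triad contributes rank `≤ C(2,1) = 2`), which is the
whole proof below; `V_A` is a cone, so the hypothesis is again a statement
`dist(⟨2,2,2⟩, V_A)² ≥ 2` about a set given by explicit degree-`11` equations in one slot.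

Why this reduction and not the three-slot one (`V_A ∩ V_B ∩ V_C`, evidence `StrassenRoute.lean` of
the `LinearDefectLaw` disprover): after exact output elimination (`sixEighthsAtFive_of_capHardRegime`)
the hypothesis reads "every 4-plane `E ⊂ M₄(ℂ)` all of whose triples have Koszul rank `≤ 10` has
`tr(P_E P_TT) ≤ 3`, `TT = M₂ ⊗ I₂`", and constrained ascent inside this one-slot variety (seat c2,
evidence `Evidence-14040-seatc2.md`: 20 runs, penalty continuation validated on fresh triples) hits a
hard ceiling at exactly `3.000000` — the one-slot relaxation is numerically TIGHT, with a flat top and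
equality families outside `σ̂₅` (e.g. `span{E₁₁⊗I, E₂₂⊗I, E₁₂⊗uu*, E₂₁⊗vv*}`), at all of which the
commutator space of `E e₀⁻¹` is an Eisenbud–Harris compression space of type `(2,0)`.  So the
load-bearing statement is a quantitative Strassen lemma in one slot; this file makes that the
formal target.
-/

set_option linter.dupNamespace false

namespace Summit.MatrixMultiplication.MatrixMultiplication.Theorems

open scoped BigOperators
open Literature.Computability.AlgebraicComplexity

/-- **`SixEighthsAtFive` from the one-slot Koszul cone.**  If the fidelity bound
`‖Σ S·⟨2,2,2⟩‖² ≤ 6·Σ‖S‖²` holds for every `2×2`-format tensor `S` whose `p = 1` Koszul flattenings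
on the output slot, `koszulFlattening 1 Φ S` for all `Φ : ℂ^{2×2} →ₗ ℂ³`, have rank `≤ 10`
(Strassen's equations for border rank `5`, Ottaviani form), then it holds for every `S` of rank
`≤ 5`, i.e. `SixEighthsAtFive`.  Proof: a rank-`≤ 5` tensor is a sum of five triads
(`exists_eq_sum_triad_of_tensorRank_le`) and each triad has Koszul rank `≤ C(2,1) = 2`
(`rank_koszulFlattening_sum_triad_le`). [folklore] -/
theorem sixEighthsAtFive_of_koszulSliceCone
    (h : ∀ S : Fin 2 × Fin 2 → Fin 2 × Fin 2 → Fin 2 × Fin 2 → ℂ,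
      (∀ Φ : (Fin 2 × Fin 2 → ℂ) →ₗ[ℂ] (Fin (2 * 1 + 1) → ℂ),
        (koszulFlattening 1 Φ S).rank ≤ 10) →
      ‖∑ a, ∑ b, ∑ c, S a b c * matMulTensor ℂ 2 2 2 a b c‖ ^ 2 ≤
        6 * ∑ a, ∑ b, ∑ c, ‖S a b c‖ ^ 2) :
    Summit.MatrixMultiplication.MatrixMultiplication.Theses.FidelityWitnesses.SixEighthsAtFive := by
  intro S hS
  refine h S fun Φ => ?_
  obtain ⟨w, u, v, rfl⟩ := exists_eq_sum_triad_of_tensorRank_le hS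
  simpa using rank_koszulFlattening_sum_triad_le 1 Φ w u v

end Summit.MatrixMultiplication.MatrixMultiplication.Theorems
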